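import Mathlib.RingTheory.GradedAlgebra.Basic
import Mathlib.Algebra.Algebra.Subalgebra.Lattice
import Mathlib.RingTheory.Ideal.Operations
import HarnessLib

/-!
# Crux `FrobeniusLadder.FRationalResolution` (stmt-ResolutionOfSingularities-15317), line `redirect`,
# stub `stub_diagonalizableQuotientResolution` — homogeneous pieces of a graded algebra generated over
# its degree-zero part by homogeneous elements are spanned by MONOMIALS (linearisation step L3, brick 4)

At a `D(A)`-fixed prime `𝔔` of a regular graded `S` the local ring `S_𝔔` is generated over
`(S₀)_𝔮` by a homogeneous regular system of parameters `x₁,…,x_n`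
(`…FixedPointGenerators.lean`, `…AdjoinParameters.lean`, `…FixedPointLocal.lean`). This file is the
graded bookkeeping that turns `L = L₀[x₁,…,x_n]` into the statements Kato's log-regularity needs:

* `decompose_mem_span_monomials`, `mem_span_monomials_of_adjoin_eq_top` — if a graded `L` (`GradedAlgebra ℒ`) is generated as an
  `L₀`-algebra by HOMOGENEOUS `x₁,…,x_n`, then every homogeneous piece `L_b` is the `L₀`-span of the
  monomials in the `xᵢ` that lie in `L_b`;
* `mem_span_monomials_of_mem_span_range` — and the degree-`0` part of the ideal `(x₁,…,x_n)` is the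
  `L₀`-span of the degree-`0` monomials lying in `(x₁,…,x_n)` (i.e. the non-trivial monomials of
  degree `0`): for the monomial chart `M = {m : Σ mᵢ deg xᵢ = 0} → L₀`, `m ↦ x^m`, Kato's ideal
  `I(𝔮) L₀` is all of `(x) ∩ L₀` — at a fixed point this is the maximal ideal of `L₀ = (S₀)_𝔮`, so
  `L₀ / I(𝔮) = κ(𝔮)` is regular (Kato 1994 (2.1)(i)).

Honest label: elementary brick of L3 (no stub closed). No definitions, no named facts, no sorry.
[folklore; cite: SGA3, Exp. VIII §4–5] [cite: Kato1994, Def. (2.1)]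
-/

noncomputable section

-- single-problem summit: the doubled namespace component is forced
set_option linter.dupNamespace false

open DirectSum

namespace Summit.ResolutionOfSingularities.ResolutionOfSingularities.Theorems.FRationalResolution.GradedMonomials

universe u v w

variable {k : Type u} [CommRing k] {A : Type w} [DecidableEq A] [AddCommGroup A] {L : Type v}
  [CommRing L] [Algebra k L] (ℒ : A → Submodule k L) [GradedAlgebra ℒ]
  {n : ℕ} (x : Fin n → L) (a : Fin n → A) (hx : ∀ i, x i ∈ ℒ (a i))

include hx in
/-- Monomials in homogeneous generators are homogeneous. [folklore] -/
theorem closure_range_le_homogeneousSubmonoid :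
    Submonoid.closure (Set.range x) ≤ SetLike.homogeneousSubmonoid ℒ := by
  refine Submonoid.closure_le.mpr ?_
  rintro _ ⟨i, rfl⟩
  exact ⟨a i, hx i⟩

include hx in
/-- Every homogeneous component of every element of `L = L₀[x₁,…,x_n]` (homogeneous `xᵢ`) is an
`L₀`-combination of monomials of that degree (the degree-`c` projection is `L₀`-linear and keeps
exactly the monomials of degree `c`). [folklore] -/
theorem decompose_mem_span_monomials (hgen : Algebra.adjoin (ℒ 0) (Set.range x) = ⊤) (y : L)
    (c : A) :
    (decompose ℒ y c : L) ∈
      Submodule.span (ℒ 0) ((Submonoid.closure (Set.range x) : Set L) ∩ (ℒ c : Set L)) := by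
  classical
  have hmem : y ∈ Subalgebra.toSubmodule (Algebra.adjoin (ℒ 0) (Set.range x)) := by
    rw [hgen, Algebra.top_toSubmodule]
    exact Submodule.mem_top
  rw [Algebra.adjoin_eq_span] at hmem
  have hsub := closure_range_le_homogeneousSubmonoid ℒ x a hx
  induction hmem using Submodule.span_induction generalizing c with
  | mem z hz =>
    obtain ⟨d, hzd⟩ : SetLike.IsHomogeneousElem ℒ z := hsub hz
    by_cases hdc : d = c
    · subst hdc
      rw [decompose_of_mem_same ℒ hzd]
      exact Submodule.subset_span ⟨hz, hzd⟩
    · rw [decompose_of_mem_ne ℒ hzd hdc]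
      exact Submodule.zero_mem _
  | zero =>
    rw [decompose_zero, zero_apply, ZeroMemClass.coe_zero]
    exact Submodule.zero_mem _
  | add z w _ _ hz hw =>
    rw [decompose_add, add_apply, Submodule.coe_add]
    exact Submodule.add_mem _ (hz c) (hw c)
  | smul r z _ hz =>
    rw [Algebra.smul_def, show algebraMap (ℒ 0) L r = (r : L) from rfl,
      coe_decompose_mul_of_left_mem_zero ℒ r.2, ← show algebraMap (ℒ 0) L r = (r : L) from rfl,
      ← Algebra.smul_def]
    exact Submodule.smul_mem _ r (hz c)

include hx in
/-- **Homogeneous pieces are spanned by monomials.** If the graded algebra `L` is generated over its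
degree-`0` part `L₀` by homogeneous elements `x₁,…,x_n`, then every `y ∈ L_b` is an `L₀`-linear
combination of monomials `x^m` lying in `L_b`. [folklore] -/
theorem mem_span_monomials_of_adjoin_eq_top
    (hgen : Algebra.adjoin (ℒ 0) (Set.range x) = ⊤) (b : A) (y : L) (hy : y ∈ ℒ b) :
    y ∈ Submodule.span (ℒ 0) ((Submonoid.closure (Set.range x) : Set L) ∩ (ℒ b : Set L)) := by
  have h := decompose_mem_span_monomials ℒ x a hx hgen y b
  rwa [decompose_of_mem_same ℒ hy] at h

include hx in
/-- **The degree-zero part of the ideal `(x₁,…,x_n)` is spanned over `L₀` by the degree-zero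
monomials it contains.** If `L = L₀[x₁,…,x_n]` with `xᵢ ∈ L_{aᵢ}` and `y ∈ L₀ ∩ (x₁,…,x_n)`, then
`y` is an `L₀`-combination of monomials `x^m ∈ (x₁,…,x_n)` of degree `0`: write `y = Σ cᵢ xᵢ`,
project to degree `0` (`y = Σ (cᵢ)_{−aᵢ} xᵢ`) and expand `(cᵢ)_{−aᵢ}` in monomials of degree `−aᵢ`
(`mem_span_monomials_of_adjoin_eq_top`). This is Kato's `I(𝔮)·L₀ ⊇ (x) ∩ L₀` for the monomial
chart at a fixed point. [folklore; cite: Kato1994, Def. (2.1)] -/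
theorem mem_span_monomials_of_mem_span_range
    (hgen : Algebra.adjoin (ℒ 0) (Set.range x) = ⊤) (y : L) (hy0 : y ∈ ℒ 0)
    (hyJ : y ∈ Ideal.span (Set.range x)) :
    y ∈ Submodule.span (ℒ 0) {μ : L | μ ∈ Submonoid.closure (Set.range x) ∧ μ ∈ ℒ 0 ∧
      μ ∈ Ideal.span (Set.range x)} := by
  classical
  obtain ⟨c, hc⟩ := Ideal.mem_span_range_iff_exists_fun.mp hyJ
  -- project `y = Σ cᵢ xᵢ` to degree `0`
  have hy : y = ∑ i, (decompose ℒ (c i) (-a i) : L) * x i := by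
    have h0 : GradedRing.proj ℒ 0 y = y := by
      rw [GradedRing.proj_apply]; exact decompose_of_mem_same ℒ hy0
    rw [← h0, ← hc, map_sum]
    refine Finset.sum_congr rfl fun i _ => ?_
    rw [GradedRing.proj_apply]
    have h := coe_decompose_mul_add_of_right_mem ℒ (i := -a i) (a := c i) (hx i)
    rwa [neg_add_cancel] at h
  rw [hy]
  refine Submodule.sum_mem _ fun i _ => ?_
  -- `(cᵢ)_{−aᵢ}` is a combination of monomials of degree `−aᵢ`; multiply by `xᵢ`
  have hci := mem_span_monomials_of_adjoin_eq_top ℒ x a hx hgen (-a i) _ (decompose ℒ (c i) (-a i)).2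
  have hmap : (decompose ℒ (c i) (-a i) : L) * x i ∈
      Submodule.map (LinearMap.mulRight (ℒ 0) (x i))
        (Submodule.span (ℒ 0) ((Submonoid.closure (Set.range x) : Set L) ∩ (ℒ (-a i) : Set L))) :=
    ⟨_, hci, rfl⟩
  rw [Submodule.map_span] at hmap
  refine Submodule.span_mono ?_ hmap
  rintro _ ⟨μ, ⟨hμ, hμd⟩, rfl⟩
  refine ⟨?_, ?_, ?_⟩
  · exact Submonoid.mul_mem _ hμ (Submonoid.subset_closure (Set.mem_range_self i))
  · have := SetLike.mul_mem_graded hμd (hx i)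
    rwa [neg_add_cancel] at this
  · exact Ideal.mul_mem_left _ _ (Ideal.subset_span (Set.mem_range_self i))

end Summit.ResolutionOfSingularities.ResolutionOfSingularities.Theorems.FRationalResolution.GradedMonomials

end
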